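import Literature.Geometry.Riemannian.SphericalCylinderSmallScaleDomination
import Literature.Geometry.Riemannian.SphericalZonalFourPositivity
import Literature.Geometry.Riemannian.SphericalZonalKernelSeriesDeriv
import HarnessLib

/-!
# Kernel certificates: a pointwise domination of the pulled-back Euclidean kernel by finitely many
# cylinder kernels integrates to `F_{y,t}(Φ A) ≤ (Σ cᵢ + c₀) · λ_cyl(A)`

Topic `Literature/Geometry/Riemannian`; companion of `SphericalCylinderSmallScaleDomination.lean` (same
objects: the round cylinder `N = {z ∈ ℝ⁶ | ∑_{i<5} zᵢ² = 1} = S⁴ × ℝ`, the conformal map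
`Φ(z) = e^{z₅} z' ∈ ℝ⁵`, the typed cylinder kernels `K_{p,σ}`, densities `F̂_{p,σ}` and entropy `λ_cyl`
of `SphericalCylinderEntropy.lean`, and the Colding–Minicozzi Gaussian areas `F_{y,t}` of
`ColdingMinicozziEntropy.lean` on `ℝ⁵`).

THE STATEMENT (`gaussianArea_conformal_le_of_certificate`). Fix a Euclidean centre `y ∈ ℝ⁵`, a scale
`t > 0`, finitely many cylinder centres `pᵢ ∈ N`, scales `σᵢ > 0` and weights `cᵢ ≥ 0`, and an "area atom"
weight `c₀ ≥ 0`. If the Jacobian-weighted pulled-back Euclidean kernel is dominated POINTWISE on `N`,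
`(4πt)⁻² e^{4z₅} e^{-‖Φz - y‖²/4t} ≤ V⁻¹ (Σᵢ cᵢ K_{pᵢ,σᵢ}(z) + c₀)` for all `z ∈ N` (`V = 8π²/3 = vol S⁴`),
then for EVERY measurable `A ⊆ N`, `F_{y,t}(Φ A) ≤ (Σᵢ cᵢ + c₀) · λ_cyl(A)`.

This is the integration step of the "conformal kernel domination" of line `conformal-kernel-domination`
(crux `CylinderEntropy.SliceIsolation`, route `SmoothPoincare4/CylinderEntropy`) isolated as an
interface: every dominating CERTIFICATE (found numerically by linear programming, or written by hand as in
`pointwise_domination`) is a finite list of real data plus ONE real inequality between explicit functions,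
and this file turns it into the bound on Gaussian areas; the slab-free domination
`λ(Φ A) ≤ C · λ_cyl(A)` is then a statement about certificates only. No bounded-height or slab
hypothesis on `A` is needed (the area atom is controlled by exhausting `A` by its bounded-height parts).

Proved here (everything; no facts, no definitions): `cylKernel_nonneg_of_mem` (the typed kernel is
`≥ 0` on `N`, from the PROVED positivity of the zonal heat kernel, `SphericalZonalKernelSeries.zonal_nonneg`),
`continuous_cylKernel` / `measurable_cylKernel`, `measure_ratio_le_cylEntropy_of_subset` (area atom without
height bound), and the certificate theorem.
-/

noncomputable section

open Set Function MeasureTheory MeasureTheory.Measure Filter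
open scoped ENNReal NNReal BigOperators Topology
open Literature.Geometry.Manifold.CylinderSlice
open Literature.Geometry.Riemannian.SphericalCylinderEntropy

namespace Literature.Geometry.Riemannian

namespace SphericalCylinderConformal

/-! ### The typed kernel on `N`: sign, continuity, measurability -/

/-- **The typed cylinder kernel is non-negative on `N`**: for `p, z ∈ N` and `σ > 0`,
`0 ≤ K_{p,σ}(z) = 𝔥(σ, ⟨z', p'⟩) e^{-(z₅-p₅)²/4σ}` (positivity of the zonal heat kernel of `S⁴` on
`[-1, 1]`, proved in the tree, and `|⟨z', p'⟩| ≤ 1`). [folklore] -/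
theorem cylKernel_nonneg_of_mem {p z : EuclideanSpace ℝ (Fin 6)}
    (hp : ∑ i : Fin 5, p (Fin.castSucc i) ^ 2 = 1) (hz : ∑ i : Fin 5, z (Fin.castSucc i) ^ 2 = 1)
    {σ : ℝ} (hσ : 0 < σ) : 0 ≤ cylKernel p σ z := by
  rw [cylKernel_eq]
  have hP := abs_le.1 (abs_sum_mul_le_one hz hp)
  exact mul_nonneg (SphericalZonalKernelSeries.zonal_nonneg hσ _ ⟨hP.1, hP.2⟩) (Real.exp_pos _).le

/-- The typed cylinder kernel `z ↦ K_{p,σ}(z)` is continuous on `ℝ⁶` for `σ > 0` (the zonal series is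
continuous on `ℝ`, `SphericalZonalKernelSeries.continuous_zonal`). [folklore] -/
theorem continuous_cylKernel (p : EuclideanSpace ℝ (Fin 6)) {σ : ℝ} (hσ : 0 < σ) :
    Continuous fun z : EuclideanSpace ℝ (Fin 6) => cylKernel p σ z := by
  have h : (fun z : EuclideanSpace ℝ (Fin 6) => cylKernel p σ z) = fun z =>
      zonal σ (∑ i : Fin 5, z (Fin.castSucc i) * p (Fin.castSucc i)) *
        Real.exp (-((z 5 - p 5) ^ 2) / (4 * σ)) := funext fun z => cylKernel_eq p σ z
  rw [h]
  have hc : Continuous fun z : EuclideanSpace ℝ (Fin 6) => ∑ i : Fin 5, z (Fin.castSucc i) * p (Fin.castSucc i) := by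
    fun_prop
  have he : Continuous fun z : EuclideanSpace ℝ (Fin 6) => Real.exp (-((z 5 - p 5) ^ 2) / (4 * σ)) := by
    fun_prop
  exact ((SphericalZonalKernelSeries.continuous_zonal hσ).comp hc).mul he

/-- The typed cylinder kernel is Borel measurable in `z` (for `σ > 0`). [folklore] -/
theorem measurable_cylKernel (p : EuclideanSpace ℝ (Fin 6)) {σ : ℝ} (hσ : 0 < σ) :
    Measurable fun z : EuclideanSpace ℝ (Fin 6) => cylKernel p σ z :=
  (continuous_cylKernel p hσ).measurable

/-! ### The area atom without a height bound -/

/-- Monotonicity of the typed cylinder entropy in the set. [folklore] -/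
theorem cylEntropy_mono {A B : Set (EuclideanSpace ℝ (Fin 6))} (h : A ⊆ B) :
    cylEntropy A ≤ cylEntropy B := by
  unfold cylEntropy cylDensity
  exact iSup₂_mono fun p _ => iSup₂_mono fun τ _ => mul_le_mul_right (lintegral_mono_set h) _

/-- **`μH⁴(A)/μH⁴(S⁴) ≤ λ_cyl(A)` for every measurable `A ⊆ N`**, without a height bound: exhaust
`A` by `A ∩ {|z₅| ≤ n}` and use the tree's bounded-height `measure_ratio_le_cylEntropy`. [folklore] -/
theorem measure_ratio_le_cylEntropy_of_subset {A : Set (EuclideanSpace ℝ (Fin 6))}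
    (hAm : MeasurableSet A) (hAN : ∀ z ∈ A, ∑ i : Fin 5, z (Fin.castSucc i) ^ 2 = 1) :
    (μH[4] (Metric.sphere (0 : EuclideanSpace ℝ (Fin 5)) 1))⁻¹ * μH[4] A ≤ cylEntropy A := by
  have hmono : Monotone fun n : ℕ => A ∩ {z : EuclideanSpace ℝ (Fin 6) | |z 5| ≤ n} := by
    intro m n hmn z hz
    exact ⟨hz.1, (show |z 5| ≤ (m : ℝ) from hz.2).trans (Nat.cast_le.2 hmn)⟩
  have hU : (⋃ n : ℕ, A ∩ {z : EuclideanSpace ℝ (Fin 6) | |z 5| ≤ n}) = A := by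
    ext z
    simp only [mem_iUnion, mem_inter_iff, mem_setOf_eq]
    refine ⟨fun ⟨n, hz, _⟩ => hz, fun hz => ?_⟩
    obtain ⟨n, hn⟩ := exists_nat_ge |z 5|
    exact ⟨n, hz, hn⟩
  have hμ : μH[4] A = ⨆ n : ℕ, μH[4] (A ∩ {z : EuclideanSpace ℝ (Fin 6) | |z 5| ≤ n}) := by
    rw [← hmono.measure_iUnion, hU]
  rw [hμ, ENNReal.mul_iSup]
  refine iSup_le fun n => ?_
  calc _ ≤ cylEntropy (A ∩ {z : EuclideanSpace ℝ (Fin 6) | |z 5| ≤ n}) :=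
        measure_ratio_le_cylEntropy
          (hAm.inter (measurableSet_le (measurable_height.abs) measurable_const))
          (fun z hz => hAN z hz.1) (B := n) (fun z hz => hz.2)
    _ ≤ cylEntropy A := cylEntropy_mono inter_subset_left

/-! ### Certificates integrate -/

/-- **Kernel certificates integrate.** Let `y ∈ ℝ⁵`, `t > 0`, and let `cᵢ ≥ 0`, `pᵢ ∈ N`, `σᵢ > 0`
(`i < m`) and `c₀ ≥ 0` be a CERTIFICATE for `(y, t)`: for every `z ∈ N`,
`(4πt)⁻² e^{4z₅} e^{-‖Φz - y‖²/4t} ≤ (3/8π²) (Σᵢ cᵢ K_{pᵢ,σᵢ}(z) + c₀)` (`Φ z = e^{z₅} z'`,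
`K = cylKernel`, `3/(8π²) = 1/vol(S⁴)`). Then for every measurable `A ⊆ N`,
`F_{y,t}(Φ A) ≤ (Σᵢ cᵢ + c₀) · λ_cyl(A)`.
Proof: layer-cake pushforward `μHE⁴⌊Φ(A) ≤ e^{4h} Φ_#(e^{4z₅} μHE⁴⌊A)` for every `h > 0`
(`lintegral_image_le_of_layers_euclidean`), the pointwise bound, `V⁻¹ ∫_A K_{pᵢ,σᵢ} dμHE⁴ = F̂_{pᵢ,σᵢ}(A)
≤ λ_cyl(A)` and `V⁻¹ μHE⁴(A) = μH⁴(A)/μH⁴(S⁴) ≤ λ_cyl(A)` (`measure_ratio_le_cylEntropy_of_subset`), then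
`h → 0`. [folklore] -/
theorem gaussianArea_conformal_le_of_certificate {m : ℕ} {c : Fin m → ℝ}
    {p : Fin m → EuclideanSpace ℝ (Fin 6)} {σ : Fin m → ℝ} {c₀ : ℝ}
    (hc : ∀ i, 0 ≤ c i) (hp : ∀ i, ∑ j : Fin 5, p i (Fin.castSucc j) ^ 2 = 1) (hσ : ∀ i, 0 < σ i)
    (hc₀ : 0 ≤ c₀) {y : EuclideanSpace ℝ (Fin 5)} {t : ℝ} (ht : 0 < t)
    (hpt : ∀ z : EuclideanSpace ℝ (Fin 6), (∑ j : Fin 5, z (Fin.castSucc j) ^ 2 = 1) →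
      ((4 * Real.pi * t) ^ 2)⁻¹ * Real.exp (4 * z 5) *
          Real.exp (-‖(WithLp.toLp 2 (fun i : Fin 5 => Real.exp (z 5) * z (Fin.castSucc i)) :
            EuclideanSpace ℝ (Fin 5)) - y‖ ^ 2 / (4 * t)) ≤
        (3 / (8 * Real.pi ^ 2)) * (∑ i, c i * cylKernel (p i) (σ i) z + c₀))
    (A : Set (EuclideanSpace ℝ (Fin 6)))
    (hAN : A ⊆ {z : EuclideanSpace ℝ (Fin 6) | ∑ i : Fin 5, z (Fin.castSucc i) ^ 2 = 1})
    (hAm : MeasurableSet A) :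
    gaussianArea 4 y t
        ((fun z : EuclideanSpace ℝ (Fin 6) =>
          (WithLp.toLp 2 (fun i : Fin 5 => Real.exp (z 5) * z (Fin.castSucc i)) :
            EuclideanSpace ℝ (Fin 5))) '' A) ≤
      ENNReal.ofReal (∑ i, c i + c₀) * cylEntropy A := by
  have hπ := Real.pi_pos
  have hAN' : ∀ z ∈ A, ∑ i : Fin 5, z (Fin.castSucc i) ^ 2 = 1 := fun z hz => hAN hz
  set F : EuclideanSpace ℝ (Fin 6) → EuclideanSpace ℝ (Fin 5) := fun z =>
    (WithLp.toLp 2 (fun i : Fin 5 => Real.exp (z 5) * z (Fin.castSucc i)) :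
      EuclideanSpace ℝ (Fin 5)) with hF_def
  have hFm : Measurable F := continuous_conf.measurable
  have hsum0 : 0 ≤ ∑ i, c i := Finset.sum_nonneg fun i _ => hc i
  -- ### the bound with an extra factor `e^{4h}`, for every `h > 0`
  have key : ∀ h : ℝ, 0 < h → gaussianArea 4 y t (F '' A) ≤
      ENNReal.ofReal (Real.exp (4 * h)) * (ENNReal.ofReal (∑ i, c i + c₀) * cylEntropy A) := by
    intro h hh
    -- Step 1: layer cake
    have hL : ∀ (M : ℝ) (S : Set (EuclideanSpace ℝ (Fin 6))), S ⊆ A → (∀ z ∈ S, z 5 ≤ M) →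
        μH[4] (F '' S) ≤ ENNReal.ofReal (Real.exp (4 * M)) * μH[4] S :=
      fun M S hS hM => hausdorffMeasure_image_conf_le M S (fun z hz => hAN' z (hS hz)) hM
    have step1 := lintegral_image_le_of_layers_euclidean hAm hFm hL (measurable_gaussianWeight y t) hh
    -- Step 2: the pointwise bound in `ℝ≥0∞`
    set V' : ℝ := 3 / (8 * Real.pi ^ 2) with hV'
    have hV'0 : 0 < V' := by positivity
    have hpt' : ∀ z ∈ A, gaussianNormalization 4 t *
        (ENNReal.ofReal (Real.exp (4 * z 5)) * gaussianWeight y t (F z)) ≤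
          ENNReal.ofReal (V' * c₀) +
            ∑ i, ENNReal.ofReal (V' * c i) * ENNReal.ofReal (cylKernel (p i) (σ i) z) := by
      intro z hz
      have hzN := hAN' z hz
      have hK0 : ∀ i, 0 ≤ cylKernel (p i) (σ i) z := fun i => cylKernel_nonneg_of_mem (hp i) hzN (hσ i)
      have hle := hpt z hzN
      rw [gaussianNormalization_four ht, gaussianWeight, hF_def]
      rw [← ENNReal.ofReal_mul (Real.exp_pos _).le, ← ENNReal.ofReal_mul (by positivity)]
      have hrhs : ENNReal.ofReal (V' * c₀) +
          ∑ i, ENNReal.ofReal (V' * c i) * ENNReal.ofReal (cylKernel (p i) (σ i) z) =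
          ENNReal.ofReal (V' * (∑ i, c i * cylKernel (p i) (σ i) z + c₀)) := by
        rw [mul_add, Finset.mul_sum, ENNReal.ofReal_add (Finset.sum_nonneg fun i _ => by
              have := hc i; have := hK0 i; positivity) (by positivity),
          ENNReal.ofReal_sum_of_nonneg (fun i _ => by have := hc i; have := hK0 i; positivity), add_comm]
        congr 1
        refine Finset.sum_congr rfl fun i _ => ?_
        rw [← ENNReal.ofReal_mul (by have := hc i; positivity)]
        ring_nf
      rw [hrhs]
      refine ENNReal.ofReal_le_ofReal ?_
      have : ((4 * Real.pi * t) ^ 2)⁻¹ * (Real.exp (4 * z 5) *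
          Real.exp (-(‖(WithLp.toLp 2 (fun i : Fin 5 => Real.exp (z 5) * z (Fin.castSucc i)) :
            EuclideanSpace ℝ (Fin 5)) - y‖ ^ 2) / (4 * t))) =
          ((4 * Real.pi * t) ^ 2)⁻¹ * Real.exp (4 * z 5) *
            Real.exp (-‖(WithLp.toLp 2 (fun i : Fin 5 => Real.exp (z 5) * z (Fin.castSucc i)) :
              EuclideanSpace ℝ (Fin 5)) - y‖ ^ 2 / (4 * t)) := by
        ring
      rw [this]
      exact hle
    -- Step 3: integrate
    have hKm : ∀ i, Measurable fun z => ENNReal.ofReal (V' * c i) * ENNReal.ofReal (cylKernel (p i) (σ i) z) :=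
      fun i => measurable_const.mul (measurable_cylKernel (p i) (hσ i)).ennreal_ofReal
    have step2 : ∫⁻ z in A, gaussianNormalization 4 t *
        (ENNReal.ofReal (Real.exp (4 * z 5)) * gaussianWeight y t (F z)) ∂μHE[4] ≤
          ENNReal.ofReal (V' * c₀) * μHE[4] A +
            ∑ i, ENNReal.ofReal (V' * c i) * ∫⁻ z in A, ENNReal.ofReal (cylKernel (p i) (σ i) z) ∂μHE[4] := by
      calc ∫⁻ z in A, gaussianNormalization 4 t *
            (ENNReal.ofReal (Real.exp (4 * z 5)) * gaussianWeight y t (F z)) ∂μHE[4]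
          ≤ ∫⁻ z in A, (ENNReal.ofReal (V' * c₀) +
              ∑ i, ENNReal.ofReal (V' * c i) * ENNReal.ofReal (cylKernel (p i) (σ i) z)) ∂μHE[4] :=
            setLIntegral_mono' hAm hpt'
        _ = _ := by
            rw [lintegral_add_left measurable_const, setLIntegral_const,
              lintegral_finsetSum _ fun i _ => hKm i]
            congr 1
            refine Finset.sum_congr rfl fun i _ => ?_
            rw [lintegral_const_mul' _ _ ENNReal.ofReal_ne_top]
    -- Step 4: from `μHE⁴` to the typed `μH⁴` ratios
    set cH : ℝ≥0∞ := ((Measure.addHaarScalarFactor (volume : Measure (EuclideanSpace ℝ (Fin 4)))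
        (μH[((4 : ℕ) : ℝ)] : Measure (EuclideanSpace ℝ (Fin 4))) : ℝ≥0) : ℝ≥0∞) with hcH_def
    have hcH0 : cH ≠ 0 :=
      ENNReal.coe_ne_zero.2 (Measure.addHaarScalarFactor_volume_hausdorffMeasure_ne_zero 4)
    have hcHtop : cH ≠ ⊤ := ENNReal.coe_ne_top
    have hμA : (μHE[4] : Measure (EuclideanSpace ℝ (Fin 6))) A = cH * μH[4] A := by
      rw [Measure.euclideanHausdorffMeasure_def, Measure.smul_apply, ENNReal.smul_def, smul_eq_mul]
      rfl
    have hIK : ∀ i, ∫⁻ z in A, ENNReal.ofReal (cylKernel (p i) (σ i) z) ∂μHE[4] =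
        cH * ∫⁻ z in A, ENNReal.ofReal (cylKernel (p i) (σ i) z) ∂μH[4] := fun i =>
      setLIntegral_euclideanHausdorffMeasure_eq_mul 4 (fun z => ENNReal.ofReal (cylKernel (p i) (σ i) z)) A
    have hS : (μHE[4] : Measure (EuclideanSpace ℝ (Fin 5))) (Metric.sphere (0 : EuclideanSpace ℝ (Fin 5)) 1) =
        cH * μH[4] (Metric.sphere (0 : EuclideanSpace ℝ (Fin 5)) 1) := by
      rw [Measure.euclideanHausdorffMeasure_def, Measure.smul_apply, ENNReal.smul_def, smul_eq_mul]
      rfl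
    have hV : ENNReal.ofReal V' = cH⁻¹ * (μH[4] (Metric.sphere (0 : EuclideanSpace ℝ (Fin 5)) 1))⁻¹ := by
      rw [hV', show (3 / (8 * Real.pi ^ 2) : ℝ) = (8 * Real.pi ^ 2 / 3)⁻¹ by field_simp,
        ENNReal.ofReal_inv_of_pos (by positivity), ← euclideanHausdorffMeasure_sphere_four, hS,
        ENNReal.mul_inv (Or.inl hcH0) (Or.inl hcHtop)]
    have hterm0 : ENNReal.ofReal (V' * c₀) * (μHE[4] : Measure (EuclideanSpace ℝ (Fin 6))) A =
        ENNReal.ofReal c₀ * ((μH[4] (Metric.sphere (0 : EuclideanSpace ℝ (Fin 5)) 1))⁻¹ * μH[4] A) := by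
      rw [mul_comm V', ENNReal.ofReal_mul hc₀, hV, hμA]
      calc ENNReal.ofReal c₀ * (cH⁻¹ * (μH[4] (Metric.sphere (0 : EuclideanSpace ℝ (Fin 5)) 1))⁻¹) *
            (cH * μH[4] A)
          = ENNReal.ofReal c₀ * (μH[4] (Metric.sphere (0 : EuclideanSpace ℝ (Fin 5)) 1))⁻¹ * (cH⁻¹ * cH) *
              μH[4] A := by ring
        _ = _ := by rw [ENNReal.inv_mul_cancel hcH0 hcHtop]; ring
    have hterm : ∀ i, ENNReal.ofReal (V' * c i) * ∫⁻ z in A, ENNReal.ofReal (cylKernel (p i) (σ i) z) ∂μHE[4] =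
        ENNReal.ofReal (c i) * cylDensity A (p i) (σ i) := by
      intro i
      rw [mul_comm V', ENNReal.ofReal_mul (hc i), hV, hIK i, cylDensity]
      calc ENNReal.ofReal (c i) *
            (cH⁻¹ * (μH[4] (Metric.sphere (0 : EuclideanSpace ℝ (Fin 5)) 1))⁻¹) *
              (cH * ∫⁻ z in A, ENNReal.ofReal (cylKernel (p i) (σ i) z) ∂μH[4])
          = ENNReal.ofReal (c i) * (cH⁻¹ * cH) *
              ((μH[4] (Metric.sphere (0 : EuclideanSpace ℝ (Fin 5)) 1))⁻¹ *
                ∫⁻ z in A, ENNReal.ofReal (cylKernel (p i) (σ i) z) ∂μH[4]) := by ring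
        _ = _ := by rw [ENNReal.inv_mul_cancel hcH0 hcHtop, mul_one]
    -- Step 5: the atoms are bounded by the cylinder entropy
    have hratio : (μH[4] (Metric.sphere (0 : EuclideanSpace ℝ (Fin 5)) 1))⁻¹ * μH[4] A ≤ cylEntropy A :=
      measure_ratio_le_cylEntropy_of_subset hAm hAN'
    have hdens : ∀ i, cylDensity A (p i) (σ i) ≤ cylEntropy A := fun i =>
      le_iSup_of_le (p i) (le_iSup_of_le (hp i) (le_iSup_of_le (σ i) (le_iSup_of_le (hσ i) le_rfl)))
    calc gaussianArea 4 y t (F '' A)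
        = gaussianNormalization 4 t * ∫⁻ w in F '' A, gaussianWeight y t w ∂μHE[4] := gaussianArea_eq _ _ _ _
      _ ≤ gaussianNormalization 4 t * (ENNReal.ofReal (Real.exp (4 * h)) *
            ∫⁻ z in A, ENNReal.ofReal (Real.exp (4 * z 5)) * gaussianWeight y t (F z) ∂μHE[4]) := by
          gcongr
      _ = ENNReal.ofReal (Real.exp (4 * h)) * ∫⁻ z in A, gaussianNormalization 4 t *
            (ENNReal.ofReal (Real.exp (4 * z 5)) * gaussianWeight y t (F z)) ∂μHE[4] := by
          rw [lintegral_const_mul' (gaussianNormalization 4 t) _ (gaussianNormalization_ne_top 4 t)]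
          ring
      _ ≤ ENNReal.ofReal (Real.exp (4 * h)) * (ENNReal.ofReal (V' * c₀) * μHE[4] A +
            ∑ i, ENNReal.ofReal (V' * c i) *
              ∫⁻ z in A, ENNReal.ofReal (cylKernel (p i) (σ i) z) ∂μHE[4]) := by
          gcongr
      _ = ENNReal.ofReal (Real.exp (4 * h)) *
            (ENNReal.ofReal c₀ * ((μH[4] (Metric.sphere (0 : EuclideanSpace ℝ (Fin 5)) 1))⁻¹ * μH[4] A) +
              ∑ i, ENNReal.ofReal (c i) * cylDensity A (p i) (σ i)) := by
          rw [hterm0]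
          congr 2
          exact Finset.sum_congr rfl fun i _ => hterm i
      _ ≤ ENNReal.ofReal (Real.exp (4 * h)) *
            (ENNReal.ofReal c₀ * cylEntropy A + ∑ i, ENNReal.ofReal (c i) * cylEntropy A) := by
          exact mul_le_mul_right (add_le_add (mul_le_mul_right hratio _)
            (Finset.sum_le_sum fun i _ => mul_le_mul_right (hdens i) _)) _
      _ = ENNReal.ofReal (Real.exp (4 * h)) * (ENNReal.ofReal (∑ i, c i + c₀) * cylEntropy A) := by
          rw [← Finset.sum_mul, ← ENNReal.ofReal_sum_of_nonneg (fun i _ => hc i), ← add_mul,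
            ← ENNReal.ofReal_add hc₀ hsum0, add_comm c₀]
  -- ### `h → 0`
  refine ENNReal.le_of_forall_lt_one_mul_le fun r hr => ?_
  rcases eq_or_ne r 0 with rfl | hr0
  · simp
  have hrt : r ≠ ⊤ := hr.ne_top
  have hρ0 : 0 < r.toReal := ENNReal.toReal_pos hr0 hrt
  have hρ1 : r.toReal < 1 := by
    have := (ENNReal.toReal_lt_toReal hrt ENNReal.one_ne_top).2 hr
    simpa using this
  have hlog : Real.log r.toReal < 0 := Real.log_neg hρ0 hρ1
  set h : ℝ := -Real.log r.toReal / 4 with hh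
  have hh0 : 0 < h := by rw [hh]; linarith
  have hexp : Real.exp (4 * h) = r.toReal⁻¹ := by
    rw [hh, show 4 * (-Real.log r.toReal / 4) = -Real.log r.toReal by ring, Real.exp_neg,
      Real.exp_log hρ0]
  have hone : r * ENNReal.ofReal (Real.exp (4 * h)) = 1 := by
    rw [hexp, ← ENNReal.ofReal_toReal hrt, ENNReal.toReal_ofReal hρ0.le,
      ← ENNReal.ofReal_mul hρ0.le, mul_inv_cancel₀ hρ0.ne', ENNReal.ofReal_one]
  calc r * gaussianArea 4 y t (F '' A)
      ≤ r * (ENNReal.ofReal (Real.exp (4 * h)) * (ENNReal.ofReal (∑ i, c i + c₀) * cylEntropy A)) :=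
        mul_le_mul_right (key h hh0) _
    _ = r * ENNReal.ofReal (Real.exp (4 * h)) * (ENNReal.ofReal (∑ i, c i + c₀) * cylEntropy A) := by ring
    _ = ENNReal.ofReal (∑ i, c i + c₀) * cylEntropy A := by rw [hone, one_mul]

end SphericalCylinderConformal

end Literature.Geometry.Riemannian

end
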